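import Summits.Ventures.PercRepro.C025ProfileSimpleReductionAll

/-!
# C-025 FROM THE PROFILE ROWS ON SIMPLE MATROIDS (night-3 g17)
`c025_of_profile : C025Profile → C025` (g6) composed with `c025Profile_of_simple` (`C025ProfileSimpleReductionAll`): the rank level-set
conjecture C-025 at every `(p, q)` on every finite matroid follows from the profile rows `(q, u)`, `q < u`, on SIMPLE finite matroids;
likewise from the Hall form on simple matroids (`profile_of_profileHall`).
No `def`, no `instance`, no notation.  Axioms: standard.
-/
namespace PercRepro

/-- **C-025 from the profile rows on simple matroids.** -/
theorem c025_of_simple_profile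
    (hsimple : ∀ {α : Type} [DecidableEq α] (N : Matroid α) [N.Finite], (∀ T ⊆ N.E, T.encard ≤ 2 → N.Indep T) →
      ∀ q u : ℕ, q < u → Profile.ProfileIneq N q u) : C025 :=
  c025_of_profile (c025Profile_of_simple hsimple)

/-- **C-025 from the Hall form on simple matroids.** -/
theorem c025_of_simple_profileHall
    (hsimple : ∀ {α : Type} [DecidableEq α] (N : Matroid α) [N.Finite], (∀ T ⊆ N.E, T.encard ≤ 2 → N.Indep T) →
      ∀ q u : ℕ, q < u → Profile.HallIneq N q u) : C025 :=
  c025_of_profile (profile_of_profileHall (profileHall_of_simple hsimple))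

end PercRepro
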